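import Summits.ResolutionOfSingularities.ResolutionOfSingularities.Theorems.EquisingularLiftEquisingularLiftNatSpecimenConeChartsAllN
import HarnessLib

/-!
# [OURS · L1 W4.5(b)] SPECIMEN: THE CONIFOLD `x₁x₂ + x₃x₄ = 0 ⊂ ℙ⁴` (cone over the smooth quadric surface) satisfies EL♮ in EVERY characteristic,
# including `2` (crux `Theses.EquisingularLift.EquisingularLiftNat`, stmt-ResolutionOfSingularities-20038)

NOT a statement of any manuscript; OURS kernel specimen (cell `res-hironaka`, chain w45b; seat res-D-pv-013, own initiative, counted 0). AI-written, weaker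
than expert review. No definition, no `sorry`, standard axioms.

The split quadric `G = T₀T₁ + T₂T₃` is a nonsingular form in EVERY characteristic (its partials are the variables themselves), unlike the Fermat quadric
(`p ≠ 2`). Hence the all-n cone theorem `ConeN.elNatAt_cone_of_isNonsingularForm` (p537155, `m = 2`) gives EL♮ for the threefold ordinary double point
— the conifold `V₊(x₁x₂ + x₃x₄) ⊂ ℙ⁴_K` — for every prime `p`: `Conifold.elNatAt_conifold`. (The surface node `x₁x₃ = x₂²` in every characteristic is
`Cone.elNatAt_quadricCone`, p527817.)
-/

set_option linter.dupNamespace false -- mandated namespace `Summit.<Summit>.<Problem>` of this single-conjunct summit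

noncomputable section

open CategoryTheory AlgebraicGeometry MvPolynomial
open Literature.AlgebraicGeometry.Resolution
open Literature.AlgebraicGeometry.Motives Literature.AlgebraicGeometry.Motives.SmoothHypersurface

namespace Summit.ResolutionOfSingularities.ResolutionOfSingularities.Cruxes.EquisingularLiftNat.Sections

namespace Conifold

variable (K : Type) [Field K]

/-- The split quadric `T₀T₁ + T₂T₃` is homogeneous of degree `2`. [folklore] -/
theorem isHomogeneous_splitQuadric : (X 0 * X 1 + X 2 * X 3 : MvPolynomial (Fin (2 + 2)) K).IsHomogeneous 2 :=
  ((isHomogeneous_X K 0).mul (isHomogeneous_X K 1)).add ((isHomogeneous_X K 2).mul (isHomogeneous_X K 3))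

/-- **The split quadric `T₀T₁ + T₂T₃` is a nonsingular form in every characteristic**: its partial derivatives are `T₁, T₀, T₃, T₂`. [folklore] -/
theorem isNonsingularForm_splitQuadric : IsNonsingularForm K (X 0 * X 1 + X 2 * X 3 : MvPolynomial (Fin (2 + 2)) K) := by
  intro 𝔭 _ _ hder i
  have h0 : pderiv 0 (X 0 * X 1 + X 2 * X 3 : MvPolynomial (Fin (2 + 2)) K) = X 1 := by
    simp only [map_add, Derivation.leibniz, pderiv_X_self, pderiv_X_of_ne (show (1 : Fin (2 + 2)) ≠ 0 by decide),
      pderiv_X_of_ne (show (2 : Fin (2 + 2)) ≠ 0 by decide), pderiv_X_of_ne (show (3 : Fin (2 + 2)) ≠ 0 by decide), smul_eq_mul]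
    ring
  have h1 : pderiv 1 (X 0 * X 1 + X 2 * X 3 : MvPolynomial (Fin (2 + 2)) K) = X 0 := by
    simp only [map_add, Derivation.leibniz, pderiv_X_self, pderiv_X_of_ne (show (0 : Fin (2 + 2)) ≠ 1 by decide),
      pderiv_X_of_ne (show (2 : Fin (2 + 2)) ≠ 1 by decide), pderiv_X_of_ne (show (3 : Fin (2 + 2)) ≠ 1 by decide), smul_eq_mul]
    ring
  have h2 : pderiv 2 (X 0 * X 1 + X 2 * X 3 : MvPolynomial (Fin (2 + 2)) K) = X 3 := by
    simp only [map_add, Derivation.leibniz, pderiv_X_self, pderiv_X_of_ne (show (0 : Fin (2 + 2)) ≠ 2 by decide),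
      pderiv_X_of_ne (show (1 : Fin (2 + 2)) ≠ 2 by decide), pderiv_X_of_ne (show (3 : Fin (2 + 2)) ≠ 2 by decide), smul_eq_mul]
    ring
  have h3 : pderiv 3 (X 0 * X 1 + X 2 * X 3 : MvPolynomial (Fin (2 + 2)) K) = X 2 := by
    simp only [map_add, Derivation.leibniz, pderiv_X_self, pderiv_X_of_ne (show (0 : Fin (2 + 2)) ≠ 3 by decide),
      pderiv_X_of_ne (show (1 : Fin (2 + 2)) ≠ 3 by decide), pderiv_X_of_ne (show (2 : Fin (2 + 2)) ≠ 3 by decide), smul_eq_mul]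
    ring
  fin_cases i
  · simpa [h1] using hder 1
  · simpa [h0] using hder 0
  · simpa [h3] using hder 3
  · simpa [h2] using hder 2

attribute [local instance] MvPolynomial.gradedAlgebra ProjBaseChange.algebraBase in
/-- **EL♮ FOR THE CONIFOLD `x₁x₂ + x₃x₄ = 0 ⊂ ℙ⁴_K` IN EVERY CHARACTERISTIC** (the threefold ordinary double point; `K` algebraically closed of
characteristic `p`, any prime `p` including `2`): `ConeN.elNatAt_cone_of_isNonsingularForm` with the split quadric. [OURS · L1 W4.5b] [folklore] -/
theorem elNatAt_conifold (p : ℕ) (hp : p.Prime) (K : Type) [Field K] [CharP K p] [IsAlgClosed K] :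
    Theorems.EquisingularLift.ELNatAt p K (2 + 2)
      (hypersurface (rename Fin.succ (X 0 * X 1 + X 2 * X 3 : MvPolynomial (Fin (2 + 2)) K) : MvPolynomial (Fin (2 + 2 + 1)) K)).left
      (hypersurfaceι (rename Fin.succ (X 0 * X 1 + X 2 * X 3 : MvPolynomial (Fin (2 + 2)) K) : MvPolynomial (Fin (2 + 2 + 1)) K)).left :=
  ConeN.elNatAt_cone_of_isNonsingularForm p hp K (by norm_num) _ (isHomogeneous_splitQuadric K) (by norm_num) (isNonsingularForm_splitQuadric K)

/-- … and it is NOT regular (the vertex): a genuine one-step instance in every characteristic. [folklore] -/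
theorem not_isRegular_conifold (K : Type) [Field K] [IsAlgClosed K] :
    ¬ Scheme.IsRegular (hypersurface (rename Fin.succ (X 0 * X 1 + X 2 * X 3 : MvPolynomial (Fin (2 + 2)) K) :
      MvPolynomial (Fin (2 + 2 + 1)) K)).left :=
  ConeN.not_isRegular_hypersurface_cone K _ (isHomogeneous_splitQuadric K) le_rfl
    ((isNonsingularForm_splitQuadric K).prime (by norm_num) (by norm_num) (isHomogeneous_splitQuadric K))

end Conifold

end Summit.ResolutionOfSingularities.ResolutionOfSingularities.Cruxes.EquisingularLiftNat.Sections

end
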